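import Mathlib
import Summits.Ventures.PercRepro2.ZMeanProof
import Summits.Ventures.PercRepro2.ZMeanBound
import Summits.Ventures.PercRepro2.StarOMain

/-!
# The coincidences `a₃ ∈ {a₁, a₂, o, b}` (blind cell PercRepro2, night-1 g9; NIGHT1-G9.md §9)

(HMF) allows every coincidence of marks except `a₁ = a₂`.  When `a₃` coincides with a root or
with `o`, the cleared mean field vanishes identically (`HMFc_a3_eq_a1`, `HMFc_a3_eq_a2`,
`HMFc_a3_eq_o`).  When `a₃ = b` it is, for EVERY finite graph and every weight vector,
`HMFc = 4 B_H m₂ + 4 B_L m₁ + 2 B_N (m₁ + m₂)` (`HMFc_a3_eq_b`), where `B_L, B_H, B_N` are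
`P(Q, b ∈ C₁)`, `P(Q, b ∈ C₂)`, `P(Q, b ∉ C₁ ∪ C₂)` and `m₁, m₂ ≥ 0` are the conditional-BHK atoms
of StarBAtoms (`m₁ = P(Q, o∈C₁, b∉U)·P(Q, b∈C₂) − P(Q, o∈C₁, b∈C₂)·P(Q, b∉U)`).  Hence **(HMF),
so (HCOV), holds whenever `a₃ = b`** (`HMF_a3_eq_b`, `HCov_a3_eq_b`) — no hypothesis on the graph.
The mean field at `a₃ = b` is `X̂ = P(Q, o∈C₁, b∈C₂) + P(Q, o∈C₂, b∈C₁)` (`Xhat_a3_eq_b`: the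
`T`-type rows by the domain Markov property, the `PD`-type rows vanish since `b ∈ C(b)`).
-/

namespace Summit.Ventures.PercRepro2

open UnionCluster CovForm

namespace Coinc

section Events

variable {V : Type*} {E : Type*} (ends : E → Sym2 V) (o a₁ a₂ b : V)

/-- With `a₃ = b`: `PD = Q ∩ {b ∉ C₁} ∩ {b ∉ C₂}`. -/
lemma PD_eq : PDEvent ends a₁ a₂ b =
    avoidAll ends a₂ {a₁} ∩ (connEvent ends a₁ b)ᶜ ∩ (connEvent ends a₂ b)ᶜ := by
  ext ω
  simp only [PDEvent, Dtilde, UnionCluster.inU, Set.mem_inter_iff, Set.mem_compl_iff, mem_connEvent,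
    Set.mem_union, not_or, PendantRoot.avoidAll_eq_compl]
  constructor
  · rintro ⟨hQ, h1, h2⟩
    exact ⟨⟨hQ, fun h => h1 (conn_symm h)⟩, fun h => h2 (conn_symm h)⟩
  · rintro ⟨⟨hQ, h1⟩, h2⟩
    exact ⟨hQ, fun h => h1 (conn_symm h), fun h => h2 (conn_symm h)⟩

/-- With `a₃ = b`: `T = Q ∩ {b ∈ C₂}`. -/
lemma T_eq : TEvent ends a₁ a₂ b = avoidAll ends a₂ {a₁} ∩ connEvent ends a₂ b := by
  ext ω
  simp only [TEvent, Set.mem_inter_iff, Set.mem_compl_iff, mem_connEvent,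
    PendantRoot.avoidAll_eq_compl]
  constructor
  · rintro ⟨hQ, h⟩; exact ⟨fun h' => hQ (conn_symm h'), h⟩
  · rintro ⟨hQ, h⟩; exact ⟨fun h' => hQ (conn_symm h'), h⟩

/-- With `a₃ = b`: `T′ = Q ∩ {b ∈ C₁}`. -/
lemma T'_eq : TEvent ends a₂ a₁ b = avoidAll ends a₂ {a₁} ∩ connEvent ends a₁ b := by
  ext ω
  simp only [TEvent, Set.mem_inter_iff, Set.mem_compl_iff, mem_connEvent,
    PendantRoot.avoidAll_eq_compl]

/-- `PD ∩ {b ∈ C₂} = ∅` at `a₃ = b`. -/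
lemma PD_inter_bH : PDEvent ends a₁ a₂ b ∩ connEvent ends a₂ b = ∅ := by
  rw [PD_eq]
  ext ω
  simp only [Set.mem_inter_iff, Set.mem_compl_iff, mem_connEvent, Set.mem_empty_iff_false,
    iff_false]
  rintro ⟨⟨_, h2⟩, h⟩
  exact h2 h

/-- `{b ∈ C₂} ∩ T = T` at `a₃ = b`. -/
lemma bH_inter_T : connEvent ends a₂ b ∩ TEvent ends a₁ a₂ b = TEvent ends a₁ a₂ b := by
  rw [T_eq]
  ext ω
  simp only [Set.mem_inter_iff, mem_connEvent]
  tauto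

/-- `{b ∈ C₁} ∩ T = ∅` at `a₃ = b`. -/
lemma bL_inter_T : connEvent ends a₁ b ∩ TEvent ends a₁ a₂ b = ∅ := by
  rw [T_eq]
  ext ω
  simp only [Set.mem_inter_iff, mem_connEvent, PendantRoot.avoidAll_eq_compl, Set.mem_compl_iff,
    Set.mem_empty_iff_false, iff_false, not_and]
  exact fun h1 hQ h2 => hQ (conn_trans h1 (conn_symm h2))

/-- Off `Q` the two root–`b` connections agree: `Qᶜ ∩ {a₂ ↔ b} = Qᶜ ∩ {a₁ ↔ b}`. -/
lemma compl_Q_inter_bH : connEvent ends a₂ b ∩ (avoidAll ends a₂ {a₁})ᶜ =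
    connEvent ends a₁ b ∩ (avoidAll ends a₂ {a₁})ᶜ := by
  ext ω
  simp only [Set.mem_inter_iff, mem_connEvent, PendantRoot.avoidAll_eq_compl, Set.mem_compl_iff,
    not_not]
  constructor
  · rintro ⟨h, hQ⟩; exact ⟨conn_trans hQ h, hQ⟩
  · rintro ⟨h, hQ⟩; exact ⟨conn_trans (conn_symm hQ) h, hQ⟩

end Events

section Masses

variable {V : Type*} {E : Type*} [Fintype E] [DecidableEq E] [Fintype V] [DecidableEq V]
  {R : Type*} [Field R] [LinearOrder R] [IsStrictOrderedRing R]

variable (p : E → R) (ends : E → Sym2 V) (o a₁ a₂ b : V)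

omit [Fintype V] [DecidableEq V] [LinearOrder R] [IsStrictOrderedRing R] in
/-- The labelling gap is `B_H − B_L`. -/
lemma gap_eq : CovForm.gap p ends a₁ a₂ b =
    prob p (avoidAll ends a₂ {a₁} ∩ connEvent ends a₂ b) -
      prob p (avoidAll ends a₂ {a₁} ∩ connEvent ends a₁ b) := by
  unfold CovForm.gap
  have h2 := prob_inter_add_prob_inter_compl p (connEvent ends a₂ b) (avoidAll ends a₂ {a₁})
  have h1 := prob_inter_add_prob_inter_compl p (connEvent ends a₁ b) (avoidAll ends a₂ {a₁})
  rw [compl_Q_inter_bH] at h2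
  rw [Set.inter_comm] at h1 h2
  linear_combination -h2 + h1

end Masses

section Rows

variable {V : Type*} {E : Type*} [Fintype E] [DecidableEq E] [Fintype V] [DecidableEq V]
  {R : Type*} [Field R] [LinearOrder R] [IsStrictOrderedRing R]

variable (p : E → R) (ends : E → Sym2 V) (o a₁ a₂ b : V)

omit [Fintype E] [DecidableEq E] [Fintype V] [DecidableEq V] in
/-- A row not containing `b` is empty. -/
lemma clusterEvent_b_eq_empty {W : Finset V} (hb : b ∉ W) :
    clusterEvent ends b (↑W : Set V) = ∅ := by
  ext ω
  simp only [mem_clusterEvent, Set.mem_empty_iff_false, iff_false]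
  intro h
  exact hb (Finset.mem_coe.1 (h ▸ mem_cluster_self ends ω b))

omit [Fintype E] [DecidableEq E] [Fintype V] [DecidableEq V] in
/-- On the row `W` a vertex of `W` is not connected to a vertex outside `W`. -/
lemma clusterEvent_inter_conn_eq_empty {W : Finset V} {x y : V} (hx : x ∈ W) (hy : y ∉ W) :
    clusterEvent ends b (↑W : Set V) ∩ connEvent ends y x = ∅ := by
  ext ω
  simp only [Set.mem_inter_iff, mem_clusterEvent, mem_connEvent, Set.mem_empty_iff_false,
    iff_false, not_and]
  intro hW h
  have hxb : Conn ends ω b x := by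
    have : x ∈ cluster ends ω b := by rw [hW]; exact Finset.mem_coe.2 hx
    exact mem_cluster.1 this
  have : y ∈ cluster ends ω b := mem_cluster.2 (conn_trans hxb (conn_symm h))
  rw [hW] at this
  exact hy (Finset.mem_coe.1 this)

omit [Fintype E] [DecidableEq E] [Fintype V] [DecidableEq V] in
/-- The same with a further event: `{C(b) = W} ∩ (X ∩ {y ↔ x}) = ∅` for `x ∈ W`, `y ∉ W`. -/
lemma clusterEvent_inter_X_conn_eq_empty {W : Finset V} {x y : V} (hx : x ∈ W) (hy : y ∉ W)
    (X : Set (Config E)) :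
    clusterEvent ends b (↑W : Set V) ∩ (X ∩ connEvent ends y x) = ∅ := by
  rw [← Set.inter_assoc, Set.inter_right_comm, clusterEvent_inter_conn_eq_empty ends b hx hy,
    Set.empty_inter]

omit [Fintype E] [DecidableEq E] [Fintype V] [DecidableEq V] in
/-- On a row containing `a₁` but not `a₂`, `Q ∩ {b ∈ C₁}` holds automatically. -/
lemma clusterEvent_inter_Q_bL {W : Finset V} (h1 : a₁ ∈ W) (h2 : a₂ ∉ W) (X : Set (Config E)) :
    clusterEvent ends b (↑W : Set V) ∩ (avoidAll ends a₂ {a₁} ∩ X ∩ connEvent ends a₁ b) =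
      clusterEvent ends b (↑W : Set V) ∩ X := by
  ext ω
  simp only [Set.mem_inter_iff, mem_clusterEvent, mem_connEvent, PendantRoot.avoidAll_eq_compl,
    Set.mem_compl_iff]
  constructor
  · rintro ⟨hW, ⟨_, hX⟩, _⟩; exact ⟨hW, hX⟩
  · rintro ⟨hW, hX⟩
    have h1b : Conn ends ω b a₁ := by
      have : a₁ ∈ cluster ends ω b := by rw [hW]; exact Finset.mem_coe.2 h1
      exact mem_cluster.1 this
    refine ⟨hW, ⟨fun h => h2 ?_, hX⟩, conn_symm h1b⟩
    have : a₂ ∈ cluster ends ω b := mem_cluster.2 (conn_trans h1b h)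
    rw [hW] at this
    exact Finset.mem_coe.1 this

omit [Fintype E] [DecidableEq E] [Fintype V] [DecidableEq V] in
/-- On a row containing `a₂` but not `a₁`, `Q ∩ {b ∈ C₂}` holds automatically. -/
lemma clusterEvent_inter_Q_bH {W : Finset V} (h1 : a₁ ∉ W) (h2 : a₂ ∈ W) (X : Set (Config E)) :
    clusterEvent ends b (↑W : Set V) ∩ (avoidAll ends a₂ {a₁} ∩ X ∩ connEvent ends a₂ b) =
      clusterEvent ends b (↑W : Set V) ∩ X := by
  ext ω
  simp only [Set.mem_inter_iff, mem_clusterEvent, mem_connEvent, PendantRoot.avoidAll_eq_compl,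
    Set.mem_compl_iff]
  constructor
  · rintro ⟨hW, ⟨_, hX⟩, _⟩; exact ⟨hW, hX⟩
  · rintro ⟨hW, hX⟩
    have h2b : Conn ends ω b a₂ := by
      have : a₂ ∈ cluster ends ω b := by rw [hW]; exact Finset.mem_coe.2 h2
      exact mem_cluster.1 this
    refine ⟨hW, ⟨fun h => h1 ?_, hX⟩, conn_symm h2b⟩
    have : a₁ ∈ cluster ends ω b := mem_cluster.2 (conn_trans h2b (conn_symm h))
    rw [hW] at this
    exact Finset.mem_coe.1 this

omit [Fintype E] [DecidableEq E] [Fintype V] [DecidableEq V] in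
/-- A row containing both roots carries `a₁ ↔ a₂`: it misses `Q`. -/
lemma clusterEvent_inter_Q_eq_empty {W : Finset V} (h1 : a₁ ∈ W) (h2 : a₂ ∈ W)
    (X Y : Set (Config E)) :
    clusterEvent ends b (↑W : Set V) ∩ (avoidAll ends a₂ {a₁} ∩ X ∩ Y) = ∅ := by
  ext ω
  simp only [Set.mem_inter_iff, mem_clusterEvent, PendantRoot.avoidAll_eq_compl,
    Set.mem_compl_iff, mem_connEvent, Set.mem_empty_iff_false, iff_false]
  rintro ⟨hW, ⟨hQ, _⟩, _⟩
  apply hQ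
  have m1 : a₁ ∈ cluster ends ω b := by rw [hW]; exact Finset.mem_coe.2 h1
  have m2 : a₂ ∈ cluster ends ω b := by rw [hW]; exact Finset.mem_coe.2 h2
  exact conn_trans (conn_symm (mem_cluster.1 m1)) (mem_cluster.1 m2)

omit [LinearOrder R] [IsStrictOrderedRing R] in
/-- A `T`-type row: `P(C(b) = W) · P_{G∖W}(x ↔ o) = P(C(b) = W, x ↔ o)` for `x ∉ W`. -/
lemma row_T {W : Finset V} {x : V} (hx : x ∉ W) :
    prob p (clusterEvent ends b (↑W : Set V)) * delConnProb p ends W x o =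
      prob p (clusterEvent ends b (↑W : Set V) ∩ connEvent ends x o) := by
  unfold delConnProb
  by_cases ho : o ∈ W
  · rw [if_pos ho, mul_zero, clusterEvent_inter_conn_eq_empty ends b ho hx, prob_empty]
  · rw [if_neg ho, prob_clusterEvent_inter_connEvent_eq_mul_connDel p ends b W hx]

omit [LinearOrder R] [IsStrictOrderedRing R] in
/-- **The mean field at `a₃ = b`**: `X̂ = P(Q, o∈C₂, b∈C₁) + P(Q, o∈C₁, b∈C₂)`. -/
theorem Xhat_a3_eq_b :
    Xhat p ends o a₁ a₂ b b =
      prob p (avoidAll ends a₂ {a₁} ∩ connEvent ends a₂ o ∩ connEvent ends a₁ b) +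
        prob p (avoidAll ends a₂ {a₁} ∩ connEvent ends a₁ o ∩ connEvent ends a₂ b) := by
  rw [Xhat_eq_sum,
    prob_eq_sum_clusterEvent p ends b
      (avoidAll ends a₂ {a₁} ∩ connEvent ends a₂ o ∩ connEvent ends a₁ b),
    prob_eq_sum_clusterEvent p ends b
      (avoidAll ends a₂ {a₁} ∩ connEvent ends a₁ o ∩ connEvent ends a₂ b),
    ← Finset.sum_add_distrib]
  refine Finset.sum_congr rfl fun W _ => ?_
  by_cases hb : b ∈ W
  · by_cases h1 : a₁ ∈ W
    · by_cases h2 : a₂ ∈ W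
      · -- both roots in the row: the row misses `Q`
        rw [clusterEvent_inter_Q_eq_empty ends a₁ a₂ b h1 h2,
          clusterEvent_inter_Q_eq_empty ends a₁ a₂ b h1 h2, prob_empty, add_zero]
        simp [termW, h1, h2]
      · -- `a₁ ∈ W`, `a₂ ∉ W`: the `T′`-row
        rw [clusterEvent_inter_Q_bL ends a₁ a₂ b h1 h2,
          clusterEvent_inter_X_conn_eq_empty ends b hb h2, prob_empty, add_zero]
        simp only [termW, if_pos h1, if_neg h2, termT, if_pos hb, mul_one]
        exact row_T p ends o b h2
    · by_cases h2 : a₂ ∈ W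
      · -- `a₂ ∈ W`, `a₁ ∉ W`: the `T`-row
        rw [clusterEvent_inter_Q_bH ends a₁ a₂ b h1 h2,
          clusterEvent_inter_X_conn_eq_empty ends b hb h1, prob_empty, zero_add]
        simp only [termW, if_neg h1, if_pos h2, termT, if_pos hb, mul_one]
        exact row_T p ends o b h1
      · -- no root in the row: the `PD`-term vanishes (`b ∈ W`), the events are empty
        rw [clusterEvent_inter_X_conn_eq_empty ends b hb h1,
          clusterEvent_inter_X_conn_eq_empty ends b hb h2, prob_empty, add_zero]
        simp only [termW, if_neg h1, if_neg h2, termPD, delShareMass, if_pos hb, mul_zero,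
          add_zero, zero_div]
  · rw [clusterEvent_b_eq_empty ends b hb, prob_empty, zero_mul, Set.empty_inter, Set.empty_inter,
      prob_empty, add_zero]

end Rows

end Coinc

end Summit.Ventures.PercRepro2
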